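import Mathlib
import Literature.NumberTheory.Transcendental.ZagierDilogarithmConjecture
import Literature.NumberTheory.Transcendental.BlochWignerDilogarithm
import Literature.NumberTheory.Transcendental.BlochWignerDilogarithmProofs
import Literature.NumberTheory.Transcendental.BlochWignerDistribution
import Summits.KontsevichZagierPeriods.KontsevichZagierPeriods.Theorems.HyperbolicBlochZagierDilogarithmConjectureDehnRigidity
import Summits.KontsevichZagierPeriods.KontsevichZagierPeriods.Theorems.HyperbolicBlochZagierDilogarithmConjectureStubCyclotomicPrimeSectorIff
import HarnessLib

/-!
# `ZagierDilogarithmConjecture` (stmt-KontsevichZagierPeriods-10550) — line `kummer-clausen-linearisation`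
(reshape c5, "the cyclotomic tower and the abelian sector"), stub `stub_milnorTwelve_iff_irrational`

**Milnor's conjecture at level 12 is the irrationality of `G / Cl₂(π/3)`**, `G = D(i)` Catalan's
constant, `Cl₂(π/3) = D(ζ₆)` — i.e. of `vol(Whitehead link)/vol(figure-eight knot) = 4G/(2D(ζ₆))`.
Let `ζ = ζ₁₂ = e^{2πi/12}` and `D = blochWignerDilog`. The line's `ℤ`-form of Milnor's conjecture at
level `N` asks that every `m : ℤ/N → ℤ` supported on the unit residues `c` with `0 < c < N/2` and
with `Σ_c m_c D(ζ_N^c) = 0` vanishes. At level `12` the admissible residues are `{1, 5}` (the units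
are `1, 5, 7, 11`), so Milnor_12 is the `ℤ`-independence of `A = D(ζ)` and `B = D(ζ⁵)`.

The two values are governed by the distribution relations `D(xᴺ) = N Σ_{m<N} D(ζ_N^m x)`
(`blochWignerDilog_pow_distribution'`) at `x = ζ`:
* `N = 3` (primitive cube root `ζ⁴`): `D(i) = D(ζ³) = 3(D(ζ) + D(ζ⁵) + D(ζ⁹))` and
  `ζ⁹ = -i = conj i`, `D(conj z) = -D(z)`, so `3(A + B) = 4·D(i)`;
* `N = 2` (primitive square root `ζ⁶ = -1`): `D(ζ₆) = D(ζ²) = 2(D(ζ) + D(ζ⁷))` and `ζ⁷ = conj ζ⁵`,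
  so `2(A − B) = D(ζ₆)`.
Hence `12(aA + bB) = 8(a + b)·D(i) + 3(a − b)·D(ζ₆)` for all integers `a, b`, and the change of
variables `(a, b) ↦ (a + b, a − b)` identifies "`A, B` are `ℤ`-independent" with "`D(i), D(ζ₆)` are
`ℤ`-independent", which (as `D(ζ₆) > 0`, `blochWignerDilog_pos`) is the irrationality of
`D(i)/D(ζ₆)`.
Sorry-free; axioms ⊆ {propext, Classical.choice, Quot.sound}.

## References

* J. Milnor, *Hyperbolic geometry: the first 150 years*, Bull. AMS 6 (1982), Appendix (the
  conjecture on the values `Л(πc/N)`; `G`, `Л(π/3)` and link/knot volumes). [Milnor1982]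
* J. L. Dupont, *Scissors congruences, group homology and characteristic classes* (2001), Cor. 8.15
  (distribution relations). [Dupont2001]
-/

noncomputable section

open scoped BigOperators ComplexConjugate
open Literature.NumberTheory.Transcendental

namespace Summit.KontsevichZagierPeriods.HyperbolicBloch.ZagierDilogarithmCyclotomic

open Summit.KontsevichZagierPeriods.HyperbolicBloch.ZagierDilogarithm (blochWignerDilog_pos)

namespace MilnorTwelve

/-- `ζ₁₂ = e^{2πi/12}` is a primitive `12`-th root of unity. [folklore] -/
theorem isPrimitiveRoot_zeta : IsPrimitiveRoot (Complex.exp (2 * Real.pi * Complex.I / 12)) 12 := by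
  simpa using Complex.isPrimitiveRoot_exp 12 (by norm_num)

/-- `ζ₁₂³ = i`. [folklore] -/
theorem zeta_pow_three : Complex.exp (2 * Real.pi * Complex.I / 12) ^ 3 = Complex.I := by
  calc Complex.exp (2 * Real.pi * Complex.I / 12) ^ 3
        = Complex.exp ((3 : ℕ) * (2 * Real.pi * Complex.I / 12)) := (Complex.exp_nat_mul _ 3).symm
    _ = Complex.exp (Real.pi / 2 * Complex.I) := by congr 1; push_cast; ring
    _ = Complex.I := Complex.exp_pi_div_two_mul_I

/-- `ζ₁₂² = ζ₆`. [folklore] -/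
theorem zeta_sq :
    Complex.exp (2 * Real.pi * Complex.I / 12) ^ 2 = Complex.exp (2 * Real.pi * Complex.I / 6) := by
  rw [← Complex.exp_nat_mul]
  congr 1
  push_cast
  ring

/-- `ζ₁₂⁹ = -i = conj i` (`ζ₁₂⁶ = i² = -1`). [folklore] -/
theorem zeta_pow_nine : Complex.exp (2 * Real.pi * Complex.I / 12) ^ 9 = conj Complex.I := by
  set z := Complex.exp (2 * Real.pi * Complex.I / 12)
  have h6 : z ^ 6 = -1 := by
    rw [show (6 : ℕ) = 3 * 2 from rfl, pow_mul, zeta_pow_three, Complex.I_sq]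
  rw [Complex.conj_I, show (9 : ℕ) = 6 + 3 from rfl, pow_add, h6, zeta_pow_three, neg_one_mul]

/-- `ζ₁₂⁷ = conj ζ₁₂⁵` (`|ζ₁₂| = 1`, `ζ₁₂¹² = 1`). [folklore] -/
theorem zeta_pow_seven :
    Complex.exp (2 * Real.pi * Complex.I / 12) ^ 7 =
      conj (Complex.exp (2 * Real.pi * Complex.I / 12) ^ 5) := by
  have h1 : ‖Complex.exp (2 * Real.pi * Complex.I / 12)‖ = 1 :=
    isPrimitiveRoot_zeta.norm'_eq_one (by norm_num)
  rw [map_pow, ← Complex.inv_eq_conj h1, inv_pow]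
  refine eq_inv_of_mul_eq_one_left ?_
  rw [← pow_add]
  exact isPrimitiveRoot_zeta.pow_eq_one

/-- **First value identity**: `3(D(ζ₁₂) + D(ζ₁₂⁵)) = 4·D(i)` — the `N = 3` distribution relation at
`x = ζ₁₂` (`ζ₁₂³ = i`, terms `D(ζ₁₂), D(ζ₁₂⁵), D(ζ₁₂⁹) = D(conj i) = -D(i)`).
[cite: Dupont2001, Cor. 8.15] -/
theorem three_mul_add_eq :
    3 * (blochWignerDilog (Complex.exp (2 * Real.pi * Complex.I / 12)) +
        blochWignerDilog (Complex.exp (2 * Real.pi * Complex.I / 12) ^ 5)) =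
      4 * blochWignerDilog Complex.I := by
  have h9 := zeta_pow_nine
  set z := Complex.exp (2 * Real.pi * Complex.I / 12)
  have h3 : IsPrimitiveRoot (z ^ 4) 3 := isPrimitiveRoot_zeta.pow (by norm_num) rfl
  have key := blochWignerDilog_pow_distribution' (by norm_num : 0 < 3) h3 z
  rw [zeta_pow_three, Finset.sum_range_succ, Finset.sum_range_succ, Finset.sum_range_one, pow_zero,
    one_mul, pow_one, show z ^ 4 * z = z ^ 5 by ring, show (z ^ 4) ^ 2 * z = z ^ 9 by ring, h9,
    blochWignerDilog_conj'] at key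
  push_cast at key
  linarith

/-- **Second value identity**: `2(D(ζ₁₂) − D(ζ₁₂⁵)) = D(ζ₆)` — the `N = 2` distribution relation at
`x = ζ₁₂` (`ζ₁₂² = ζ₆`, terms `D(ζ₁₂), D(ζ₁₂⁷) = D(conj ζ₁₂⁵) = -D(ζ₁₂⁵)`).
[cite: Dupont2001, Cor. 8.15] -/
theorem two_mul_sub_eq :
    2 * (blochWignerDilog (Complex.exp (2 * Real.pi * Complex.I / 12)) -
        blochWignerDilog (Complex.exp (2 * Real.pi * Complex.I / 12) ^ 5)) =
      blochWignerDilog (Complex.exp (2 * Real.pi * Complex.I / 6)) := by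
  have h7 := zeta_pow_seven
  set z := Complex.exp (2 * Real.pi * Complex.I / 12)
  have h2 : IsPrimitiveRoot (z ^ 6) 2 := isPrimitiveRoot_zeta.pow (by norm_num) rfl
  have key := blochWignerDilog_pow_distribution' (by norm_num : 0 < 2) h2 z
  rw [zeta_sq, Finset.sum_range_succ, Finset.sum_range_one, pow_zero, one_mul, pow_one,
    show z ^ 6 * z = z ^ 7 by ring, h7, blochWignerDilog_conj'] at key
  push_cast at key
  linarith

/-- `D(ζ₆) > 0`: `ζ₆` lies in the open upper half plane. [cite: Milnor1982, Appendix, Lemma 2] -/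
theorem blochWignerDilog_zeta_six_pos :
    0 < blochWignerDilog (Complex.exp (2 * Real.pi * Complex.I / 6)) := by
  have h := CyclotomicPrimeSector.zeta_pow_im_pos 6 (c := 1) one_pos (by norm_num)
  simp only [Nat.cast_ofNat, pow_one] at h
  exact blochWignerDilog_pos h

/-- The unit residues `c mod 12` with `0 < c < 6` are `1` and `5`. [folklore] -/
theorem eq_one_or_eq_five {c : ZMod 12} (hu : IsUnit c) (h0 : 0 < c.val) (h2 : 2 * c.val < 12) :
    c = 1 ∨ c = 5 := by
  have hcop : c.val.Coprime 12 :=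
    (ZMod.isUnit_iff_coprime c.val 12).1 (by rwa [ZMod.natCast_zmod_val])
  have hv : c.val = 1 ∨ c.val = 5 := by
    generalize c.val = v at hcop h0 h2
    have h6 : v < 6 := by omega
    interval_cases v
    · exact Or.inl rfl
    · exact absurd hcop (by decide)
    · exact absurd hcop (by decide)
    · exact absurd hcop (by decide)
    · exact Or.inr rfl
  rcases hv with hv | hv
  · exact Or.inl (ZMod.val_injective 12 (hv.trans (show (1 : ZMod 12).val = 1 from rfl).symm))
  · exact Or.inr (ZMod.val_injective 12 (hv.trans (show (5 : ZMod 12).val = 5 from rfl).symm))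

/-- A sum `Σ_{c mod 12} m_c D(ζ₁₂^c)` with `m` supported on `{1, 5}` is `m₁ D(ζ₁₂) + m₅ D(ζ₁₂⁵)`.
[folklore] -/
theorem sum_eq_of_support (m : ZMod 12 → ℤ) (hm : ∀ c, m c ≠ 0 → c = 1 ∨ c = 5) :
    ∑ c : ZMod 12, (m c : ℝ) *
        blochWignerDilog (Complex.exp (2 * Real.pi * Complex.I / 12) ^ c.val) =
      (m 1 : ℝ) * blochWignerDilog (Complex.exp (2 * Real.pi * Complex.I / 12)) +
        (m 5 : ℝ) * blochWignerDilog (Complex.exp (2 * Real.pi * Complex.I / 12) ^ 5) := by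
  rw [Fintype.sum_eq_add (1 : ZMod 12) 5 (by decide)]
  · have h1 : (1 : ZMod 12).val = 1 := rfl
    have h5 : (5 : ZMod 12).val = 5 := rfl
    rw [h1, h5, pow_one]
  · rintro c ⟨hc1, hc5⟩
    have h0 : m c = 0 := by
      by_contra h
      rcases hm c h with rfl | rfl
      · exact hc1 rfl
      · exact hc5 rfl
    rw [h0, Int.cast_zero, zero_mul]

end MilnorTwelve

/-- **Milnor's conjecture at level 12 is the irrationality of `D(i)/D(ζ₆) = G/Cl₂(π/3)`** (stub
`stub_milnorTwelve_iff_irrational` of line `kummer-clausen-linearisation`).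
`(ℤ/12)ˣ ∩ (0, 6) = {1, 5}`, and the distribution relations give `3(D(ζ₁₂) + D(ζ₁₂⁵)) = 4D(i)`,
`2(D(ζ₁₂) − D(ζ₁₂⁵)) = D(ζ₆)`, so the `ℤ`-independence of `D(ζ₁₂), D(ζ₁₂⁵)` is that of
`D(i), D(ζ₆) > 0`, i.e. `D(i)/D(ζ₆) ∉ ℚ` — equivalently
`vol(Whitehead link)/vol(4₁) = 2G/D(ζ₆) ∉ ℚ`. [cite: Milnor1982, Appendix] -/
theorem stub_milnorTwelve_iff_irrational :
    (∀ m : ZMod 12 → ℤ, (∀ c, m c ≠ 0 → IsUnit c ∧ 0 < c.val ∧ 2 * c.val < 12) →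
          ∑ c : ZMod 12, (m c : ℝ) *
              blochWignerDilog (Complex.exp (2 * Real.pi * Complex.I / 12) ^ c.val) = 0 →
            ∀ c, m c = 0) ↔
      Irrational (blochWignerDilog Complex.I /
        blochWignerDilog (Complex.exp (2 * Real.pi * Complex.I / 6))) := by
  have hW := MilnorTwelve.blochWignerDilog_zeta_six_pos
  have hAB := MilnorTwelve.three_mul_add_eq
  have hAB' := MilnorTwelve.two_mul_sub_eq
  constructor
  · intro hM
    rw [irrational_iff_ne_rational]
    intro p q hq hpq
    rw [div_eq_div_iff hW.ne' (Int.cast_ne_zero.2 hq)] at hpq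
    obtain ⟨m, hm1, hm5, hm0⟩ : ∃ m : ZMod 12 → ℤ, m 1 = 3 * q - 8 * p ∧ m 5 = 3 * q + 8 * p ∧
        ∀ c, c ≠ 1 → c ≠ 5 → m c = 0 := by
      refine ⟨fun c => if c = 1 then 3 * q - 8 * p else if c = 5 then 3 * q + 8 * p else 0,
        ?_, ?_, ?_⟩
      · simp
      · have h51 : (5 : ZMod 12) ≠ 1 := by decide
        simp [h51]
      · intro c h1 h5
        simp [h1, h5]
    have hsupp' : ∀ c, m c ≠ 0 → c = 1 ∨ c = 5 := by
      intro c hc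
      by_contra h
      push Not at h
      exact hc (hm0 c h.1 h.2)
    have hsupp : ∀ c, m c ≠ 0 → IsUnit c ∧ 0 < c.val ∧ 2 * c.val < 12 := by
      intro c hc
      rcases hsupp' c hc with rfl | rfl
      · exact ⟨isUnit_one, by decide⟩
      · exact ⟨IsUnit.of_mul_eq_one (5 : ZMod 12) (by decide), by decide⟩
    have hsum : ∑ c : ZMod 12, (m c : ℝ) *
        blochWignerDilog (Complex.exp (2 * Real.pi * Complex.I / 12) ^ c.val) = 0 := by
      rw [MilnorTwelve.sum_eq_of_support m hsupp', hm1, hm5]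
      push_cast
      linear_combination (q : ℝ) * hAB - 4 * (p : ℝ) * hAB' + 4 * hpq
    have h1 := hM m hsupp hsum 1
    have h5 := hM m hsupp hsum 5
    rw [hm1] at h1
    rw [hm5] at h5
    omega
  · intro hx m hsupp hsum
    have hsupp' : ∀ c, m c ≠ 0 → c = 1 ∨ c = 5 := fun c hc =>
      MilnorTwelve.eq_one_or_eq_five (hsupp c hc).1 (hsupp c hc).2.1 (hsupp c hc).2.2
    rw [MilnorTwelve.sum_eq_of_support m hsupp'] at hsum
    have hrel : 8 * ((m 1 : ℝ) + m 5) * blochWignerDilog Complex.I +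
        3 * ((m 1 : ℝ) - m 5) *
          blochWignerDilog (Complex.exp (2 * Real.pi * Complex.I / 6)) = 0 := by
      linear_combination 12 * hsum - 2 * ((m 1 : ℝ) + m 5) * hAB - 3 * ((m 1 : ℝ) - m 5) * hAB'
    have hab : m 1 + m 5 = 0 := by
      by_contra h
      refine (irrational_iff_ne_rational _).1 hx (-(3 * (m 1 - m 5))) (8 * (m 1 + m 5))
        (by omega) ?_
      rw [div_eq_div_iff hW.ne' (Int.cast_ne_zero.2 (by omega))]
      push_cast
      linear_combination hrel
    have hab' : m 1 - m 5 = 0 := by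
      rw [show ((m 1 : ℝ) + m 5) = 0 by exact_mod_cast hab, mul_zero, zero_mul, zero_add] at hrel
      rcases mul_eq_zero.1 hrel with h | h
      · exact_mod_cast (show ((m 1 : ℝ) - m 5) = 0 by linarith)
      · exact absurd h hW.ne'
    have hm1 : m 1 = 0 := by omega
    have hm5 : m 5 = 0 := by omega
    intro c
    by_contra hc
    rcases hsupp' c hc with rfl | rfl
    · exact hc hm1
    · exact hc hm5

end Summit.KontsevichZagierPeriods.HyperbolicBloch.ZagierDilogarithmCyclotomic

end
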